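import Summits.QuantumFields.BalabanUV.Gaps.BlockPairProfileMass

/-!
# `BalabanUV.Gaps.BlockPairCriticalOffBlock` — cell `pub-balaban-gaps` (YM blitz Y1), track G1, seat g1-p1 (GEN 5), row (D1): **DISTINCT BLOCKS AT THE
# CRITICAL RIESZ EXPONENT `p = d` ARE LOG-FREE** — `y ≠ y′ ⟹ Σ_{x∈B n y} Σ_{x′∈B n y′} nrm(x−x′)^{−d} ≤ (1 + 6d·3^{d−1})·(n+1)^d` (any `d ≥ 1`; `d = 4`:
# `≤ 649·n⁴` for blocks of side `n`), a refinement of the all-pairs critical count `n^d·(1 + 2d·3^{d−1}·(1 + log(2n−1)))` (b2b leaf-04 g25's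
# `D1BFx/BlockPairRieszCount.sum_box_box_inv_nrm_four_le_d4`, «the two bare legs» log of the ghost (d1) rows): the logarithm is carried by the
# SAME-block pair ONLY.

HONEST FRAMING (cell rule, page 1 of everything).  WHAT THIS IS: elementary counting on `ℤ^d` (one Riesz kernel between two blocks: per row a harmonic
TAIL `Σ_{j ≥ s(x)} 1∕j ≤ 1 + log((2n+1)∕s(x))` where `s(x)` is the distance of `x` to the separating face, and `Σ_{s ≤ n+1} log((2n+1)∕s) ≤ 3(n+1)` by
`N log N − N ≤ log N!`), composed BY NAME from leaf-04's `D1BFx.LatticeHLSRadial.sum_radial_le`, Mathlib's harmonic bounds (`harmonic_le_one_add_log`,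
`log_add_one_le_harmonic`), `Real.pow_div_factorial_le_exp`, and this seat's `Gaps.BlockPairProfileMass` block geometry.  WHAT THIS IS NOT: not a word of
Bałaban's; no kernel of the road is bounded; which WORDS of slot (K) carry which `log` is the owners' power count (leaf-04 g25 GHOST-N8-SPEC N-1, the owner's
U1 ∕ UNIT PAGE) — this file records only that the COUNT's logarithm sits in the same-block class, the class with ZERO (1.22) weight for `μ ≠ ν`
(`Gaps/D1ReadoutCrossWeight`; so do the face classes); (D1) NOT discharged; 0∕4 row-D1 binders; (K) NOT closed; NOT `BetaPertH`, NOT the continuum limit,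
NOT Clay.  HONEST DEPENDENCY (b2b cell, verbatim): «continuum YM on T⁴ ⇐ BetaPertH ∧ nine spine estimates (0/9 proved); BetaPertH ⇐ (D1) ∧ (D4) ∧ CAP+tail;
G-an2-4 gates asym, D1 and NE2/3/4.»

LOCATED NUMBERS (stdlib, `HOME/pub-balaban-gaps-g1-p1/g5/blockpair_count.out`): `S₄(n,z)∕n⁴` := `Σ_{x∈B₀,x′∈B_z} nrm(x−x′)⁻⁴ ∕ n⁴` at `d = 4`: SAME block
32.9 ∕ 59.5 ∕ 79.1 ∕ 106.7 ∕ 126.1 ∕ 147.4 (n = 3, 5, 7, 11, 15, 21; `∕(n⁴ log n)` = 29.9 → 48.4, rising), FACE class 6.1 → 8.15, EDGE class `e_μ+e_ν` 1.60 → 1.46 —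
the kernel constant 649 holds off the diagonal block with ≥ 75× slack.

CONTENT (all [folklore]; `κ_d := 2d·3^{d−1}`).
* §1 one-dimensional sums: `sum_Icc_inv_le_log` (harmonic tail `Σ_{j=s}^{M} 1∕j ≤ 1 + log M − log s`), `sum_range_log_succ_eq_log_factorial`,
  `mul_log_sub_le_log_factorial` (`N log N − N ≤ log N!`), `sum_range_one_add_log_sub_log_le` (`Σ_{i<N}(1 + log M − log(i+1)) ≤ 3N` for `M ≤ 2N`).
* §2 blocks: `sum_B_inv_nrm_crit_le_harmonicTail` (critical ROW with an inner radius), `le_supNorm_sub_of_mem_B_succ` ∕ `supNorm_sub_le_of_mem_B_near`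
  (adjacent geometry: `n + 1 − loc_i(x) ≤ ‖x′ − x‖∞ ≤ 2n + 1`), `sum_B_of_loc` (a function of one local coordinate summed over a block = `(n+1)^{d−1}·Σ_{t<n+1}`,
  via `Fin.insertNthEquiv`), **`sum_B_sum_B_inv_nrm_crit_le_of_succ`** (adjacent, `≤ 6d·3^{d−1}·(n+1)^d`), `sum_B_sum_B_inv_nrm_pow_le_of_far` (`‖y−y′‖∞ ≥ 2`,
  any `p ≤ 2d`: `≤ (n+1)^{2d−p}`), **`sum_B_sum_B_inv_nrm_crit_le_of_ne`** (`y ≠ y′`: `≤ (1 + 6d·3^{d−1})·(n+1)^d`, orientation by the symmetry `x ↔ x′`).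
* §3 `d = 4`, blocks `B (n−1) y` of side `n`: **`sum_B_sum_B_inv_nrm_four_le_of_ne_four`** (`≤ 649·n⁴`).
Imports `Gaps.BlockPairProfileMass` only; no `def`, no `def … : Prop`, nothing cited, 0 sorry; axioms ⊆ the standard trio.  Provenance: cell pub-balaban-gaps, seat
g1-p1 GEN 5, 2026-08-23; INTENT I-gapsg1p1-12 (first refusal leaf-04 g25 — a refinement of THEIR critical count).
-/

namespace Summit.QuantumFields.BalabanUV.Gaps.BlockPairCriticalOffBlock

open Finset Real
open Literature.MathematicalPhysics.QuantumFieldTheory.Balaban1983to89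
open Literature.MathematicalPhysics.QuantumFieldTheory.Balaban1983to89.Beta
open B6QGQLower276 (X blk loc side B mem_B side_mul_blk_add_loc loc_nonneg loc_le sum_B chart loc_chart)
open B6QGQDecay237 (card_B)
open PoissonInterior (supNorm nrm nrm_pos one_le_nrm supNorm_le_nrm nrm_neg supNorm_neg natAbs_le_supNorm exists_natAbs_eq_supNorm supNorm_le_iff
  natAbs_le_iff_abs_le le_supNorm_of)
open Summit.QuantumFields.BalabanUV.Beta.D1BFx.LatticeHLSRadial (sum_radial_le max_one_cast)
open Summit.QuantumFields.BalabanUV.Gaps.BlockPairProfileMass (supNorm_sub_ge_of_mem_B nrm_sub_comm cast_pred_add_one)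

noncomputable section

variable {d : ℕ}

/-! ## §1–§2 One-dimensional sums; distinct blocks at the critical exponent -/

section CriticalOffBlock

/-- [folklore] Critical ROW with an inner radius: if every `x′ ∈ B n y′` is at sup distance `∈ [s, M]` from `x` (`s ≥ 1`), then
`Σ_{x′ ∈ B n y′} nrm(x − x′)^{−d} ≤ 2d·3^{d−1}·Σ_{j=s}^{M} 1∕j`. -/
theorem sum_B_inv_nrm_crit_le_harmonicTail (hd : 0 < d) {n : ℕ} (x y' : X d) {s M : ℕ} (hs : 1 ≤ s)
    (hlow : ∀ x' ∈ B n y', s ≤ supNorm (x' - x)) (hM : ∀ x' ∈ B n y', supNorm (x' - x) ≤ M) :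
    ∑ x' ∈ B n y', 1 / nrm (x - x') ^ d ≤ 2 * d * 3 ^ (d - 1) * ∑ j ∈ Finset.Icc s M, 1 / (j : ℝ) := by
  have hφ : ∀ j : ℕ, 0 ≤ 1 / (max (1 : ℝ) (j : ℝ)) ^ d := fun j => by positivity
  have h := sum_radial_le hd hφ (B n y') x hs hlow hM
  have e : ∀ x' : X d, 1 / nrm (x - x') ^ d = 1 / (max (1 : ℝ) (supNorm (x' - x) : ℝ)) ^ d := fun x' => by
    rw [nrm_sub_comm]; rfl
  simp_rw [e]
  refine h.trans (mul_le_mul_of_nonneg_left (Finset.sum_le_sum fun j hj => ?_) (by positivity))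
  have hj1 : 1 ≤ j := hs.trans (Finset.mem_Icc.mp hj).1
  have hj0 : (0 : ℝ) < j := by exact_mod_cast hj1
  have ed : (j : ℝ) ^ d = (j : ℝ) ^ (d - 1) * j := by rw [← pow_succ, Nat.sub_add_cancel hd]
  rw [max_one_cast hj1, ed]
  exact le_of_eq (by field_simp)

/-- [folklore] Harmonic tail: `Σ_{j=s}^{M} 1∕j ≤ 1 + log M − log s` for `1 ≤ s ≤ M`. -/
theorem sum_Icc_inv_le_log {s M : ℕ} (hs : 1 ≤ s) (hsM : s ≤ M) :
    ∑ j ∈ Finset.Icc s M, 1 / (j : ℝ) ≤ 1 + Real.log M - Real.log s := by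
  have hM : harmonic M ≤ 1 + Real.log M := harmonic_le_one_add_log M
  have hs' : Real.log s ≤ harmonic (s - 1) := by
    have h := log_add_one_le_harmonic (s - 1)
    rwa [Nat.sub_add_cancel hs] at h
  have hsplit : (harmonic M : ℝ) = (harmonic (s - 1) : ℝ) + ∑ j ∈ Finset.Icc s M, 1 / (j : ℝ) := by
    rw [harmonic_eq_sum_Icc, harmonic_eq_sum_Icc, Rat.cast_sum, Rat.cast_sum]
    have hdisj : Disjoint (Finset.Icc 1 (s - 1)) (Finset.Icc s M) := by
      rw [Finset.disjoint_left]; intro j hj hj'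
      have := (Finset.mem_Icc.mp hj).2; have := (Finset.mem_Icc.mp hj').1; omega
    have hunion : Finset.Icc 1 M = Finset.Icc 1 (s - 1) ∪ Finset.Icc s M := by
      ext j; simp only [Finset.mem_union, Finset.mem_Icc]; omega
    rw [hunion, Finset.sum_union hdisj]
    simp only [Rat.cast_inv, Rat.cast_natCast, one_div]
  linarith

/-- [folklore] `Σ_{i<N} log (i+1) = log N!`. -/
theorem sum_range_log_succ_eq_log_factorial (N : ℕ) :
    ∑ i ∈ Finset.range N, Real.log ((i : ℝ) + 1) = Real.log (N.factorial) := by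
  rw [← Finset.prod_range_add_one_eq_factorial, Nat.cast_prod, Real.log_prod]
  · exact Finset.sum_congr rfl fun i _ => by push_cast; ring_nf
  · intro i _; positivity

/-- [folklore] `N log N − N ≤ log N!` (from `N^N ∕ N! ≤ e^N`). -/
theorem mul_log_sub_le_log_factorial (N : ℕ) : (N : ℝ) * Real.log N - N ≤ Real.log (N.factorial) := by
  rcases Nat.eq_zero_or_pos N with rfl | hN
  · simp
  have hN' : (0 : ℝ) < N := by exact_mod_cast hN
  have hfac : (0 : ℝ) < N.factorial := by exact_mod_cast Nat.factorial_pos N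
  have h := Real.pow_div_factorial_le_exp (x := (N : ℝ)) hN'.le N
  have h2 : Real.log ((N : ℝ) ^ N / N.factorial) ≤ Real.log (Real.exp N) :=
    Real.log_le_log (by positivity) h
  rw [Real.log_exp, Real.log_div (by positivity) hfac.ne', Real.log_pow] at h2
  linarith

/-- [folklore] `Σ_{i<N} (1 + log M − log (i+1)) ≤ 3N` when `1 ≤ M ≤ 2N`. -/
theorem sum_range_one_add_log_sub_log_le {N M : ℕ} (hN : 1 ≤ N) (hM1 : 1 ≤ M) (hM : M ≤ 2 * N) :
    ∑ i ∈ Finset.range N, (1 + Real.log M - Real.log ((i : ℝ) + 1)) ≤ 3 * N := by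
  have hN' : (0 : ℝ) < N := by exact_mod_cast hN
  have hM' : (0 : ℝ) < M := by exact_mod_cast hM1
  rw [Finset.sum_sub_distrib, Finset.sum_const, Finset.card_range, nsmul_eq_mul, sum_range_log_succ_eq_log_factorial]
  have h1 := mul_log_sub_le_log_factorial N
  have h2 : Real.log M ≤ Real.log 2 + Real.log N := by
    rw [← Real.log_mul (by norm_num) hN'.ne']
    exact Real.log_le_log hM' (by exact_mod_cast hM)
  have h3 : Real.log 2 ≤ 1 := by
    have := Real.log_two_lt_d9; linarith
  nlinarith

/-- [folklore] ADJACENT GEOMETRY, lower bound: if `y′ i = y i + 1` then every `x′ ∈ B n y′` is at sup distance `≥ n + 1 − loc_i(x)` from `x ∈ B n y`. -/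
theorem le_supNorm_sub_of_mem_B_succ {n : ℕ} {y y' : X d} {i : Fin d} (hi : y' i = y i + 1)
    {x x' : X d} (hx : x ∈ B n y) (hx' : x' ∈ B n y') :
    n + 1 - (loc n x i).toNat ≤ supNorm (x' - x) := by
  have h1 := side_mul_blk_add_loc n x i
  have h2 := side_mul_blk_add_loc n x' i
  rw [mem_B.1 hx] at h1
  rw [mem_B.1 hx', hi] at h2
  have l1 := loc_nonneg n x i; have l2 := loc_le n x i; have l3 := loc_nonneg n x' i
  have hside : side n = (n : ℤ) + 1 := rfl
  rw [hside] at h1 h2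
  have ht : ((loc n x i).toNat : ℤ) = loc n x i := Int.toNat_of_nonneg l1
  have hle : (loc n x i).toNat ≤ n + 1 := by omega
  apply le_supNorm_of (i := i)
  have e : (x' - x) i = (n : ℤ) + 1 + (loc n x' i - loc n x i) := by
    rw [Pi.sub_apply]; linear_combination h1 - h2
  rw [Nat.cast_sub hle]
  push_cast
  rw [ht]
  calc (n : ℤ) + 1 - loc n x i ≤ (x' - x) i := by rw [e]; linarith
    _ ≤ |(x' - x) i| := le_abs_self _

/-- [folklore] ADJACENT GEOMETRY, upper bound: if `‖y′ − y‖∞ ≤ 1` then any two sites of `B n y`, `B n y′` are at sup distance `≤ 2n + 1`. -/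
theorem supNorm_sub_le_of_mem_B_near {n : ℕ} {y y' : X d} (hyy : supNorm (y' - y) ≤ 1)
    {x x' : X d} (hx : x ∈ B n y) (hx' : x' ∈ B n y') : supNorm (x' - x) ≤ 2 * n + 1 := by
  rw [supNorm_le_iff]
  intro j
  have h1 := side_mul_blk_add_loc n x j
  have h2 := side_mul_blk_add_loc n x' j
  rw [mem_B.1 hx] at h1
  rw [mem_B.1 hx'] at h2
  have l1 := loc_nonneg n x j; have l2 := loc_le n x j; have l3 := loc_nonneg n x' j; have l4 := loc_le n x' j
  have hside : side n = (n : ℤ) + 1 := rfl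
  rw [hside] at h1 h2
  have hy : |(y' - y) j| ≤ 1 := by
    have := natAbs_le_supNorm (y' - y) j
    have h3 : ((y' - y) j).natAbs ≤ 1 := this.trans hyy
    rw [natAbs_le_iff_abs_le] at h3; exact_mod_cast h3
  rw [natAbs_le_iff_abs_le]
  rw [Pi.sub_apply] at hy
  have e : (x' - x) j = ((n : ℤ) + 1) * (y' j - y j) + (loc n x' j - loc n x j) := by rw [Pi.sub_apply]; linarith
  rw [e, abs_le]
  rw [abs_le] at hy
  push_cast
  constructor <;> nlinarith [hy.1, hy.2]

/-- [folklore] FIBRE SUM: a function of the `i`-th local coordinate summed over a block is `(n+1)^{d−1}` times its sum over the coordinate range. -/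
theorem sum_B_of_loc (hd : 0 < d) {n : ℕ} (y : X d) (i : Fin d) (g : ℕ → ℝ) :
    ∑ x ∈ B n y, g (loc n x i).toNat = ((n : ℝ) + 1) ^ (d - 1) * ∑ t ∈ Finset.range (n + 1), g t := by
  rw [sum_B]
  have e : ∀ z : Fin d → Fin (n + 1), g (loc n (chart n y z) i).toNat = g (z i : ℕ) := fun z => by
    rw [loc_chart]; rfl
  simp_rw [e]
  obtain ⟨m, rfl⟩ := Nat.exists_eq_succ_of_ne_zero hd.ne'
  rw [← (Fin.insertNthEquiv (fun _ => Fin (n + 1)) i).sum_comp]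
  simp only [Fin.insertNthEquiv_apply, Fin.insertNth_apply_same]
  rw [Fintype.sum_prod_type]
  simp only [Finset.sum_const, Finset.card_univ, nsmul_eq_mul]
  rw [← Finset.mul_sum, Fin.sum_univ_eq_sum_range (fun t => g t) (n + 1), Fintype.card_fun, Fintype.card_fin,
    Fintype.card_fin, Nat.succ_sub_one]
  push_cast; ring

/-- [folklore] **ADJACENT BLOCKS (`y′ i = y i + 1`) AT THE CRITICAL EXPONENT ARE LOG-FREE**:
`Σ_{x∈B n y} Σ_{x′∈B n y′} nrm(x−x′)^{−d} ≤ 6d·3^{d−1}·(n+1)^d` (per row a harmonic tail `log((2n+1)∕s)`, and `Σ_{s≤n+1} log((2n+1)∕s) ≤ 3(n+1)`). -/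
theorem sum_B_sum_B_inv_nrm_crit_le_of_succ (hd : 0 < d) (n : ℕ) {y y' : X d} (hyy : supNorm (y' - y) ≤ 1)
    {i : Fin d} (hi : y' i = y i + 1) :
    ∑ x ∈ B n y, ∑ x' ∈ B n y', 1 / nrm (x - x') ^ d ≤ 6 * d * 3 ^ (d - 1) * ((n : ℝ) + 1) ^ d := by
  have hκ : (0 : ℝ) ≤ 2 * d * 3 ^ (d - 1) := by positivity
  -- per row
  have hrow : ∀ x ∈ B n y, ∑ x' ∈ B n y', 1 / nrm (x - x') ^ d
      ≤ 2 * d * 3 ^ (d - 1) * (1 + Real.log ((2 * n + 1 : ℕ) : ℝ) - Real.log ((n + 1 - (loc n x i).toNat : ℕ) : ℝ)) := by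
    intro x hx
    have l1 := loc_nonneg n x i; have l2 := loc_le n x i
    have ht : ((loc n x i).toNat : ℤ) = loc n x i := Int.toNat_of_nonneg l1
    have hs1 : 1 ≤ n + 1 - (loc n x i).toNat := by omega
    have hsM : n + 1 - (loc n x i).toNat ≤ 2 * n + 1 := by omega
    refine (sum_B_inv_nrm_crit_le_harmonicTail hd x y' hs1 (fun x' hx' => le_supNorm_sub_of_mem_B_succ hi hx hx')
      (fun x' hx' => supNorm_sub_le_of_mem_B_near hyy hx hx')).trans ?_
    exact mul_le_mul_of_nonneg_left (sum_Icc_inv_le_log hs1 hsM) hκ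
  refine (Finset.sum_le_sum hrow).trans ?_
  rw [← Finset.mul_sum, sum_B_of_loc hd y i (fun t => 1 + Real.log ((2 * n + 1 : ℕ) : ℝ) - Real.log ((n + 1 - t : ℕ) : ℝ))]
  -- reflect the range sum
  have hrefl : ∑ t ∈ Finset.range (n + 1), (1 + Real.log ((2 * n + 1 : ℕ) : ℝ) - Real.log ((n + 1 - t : ℕ) : ℝ))
      = ∑ j ∈ Finset.range (n + 1), (1 + Real.log ((2 * n + 1 : ℕ) : ℝ) - Real.log ((j : ℝ) + 1)) := by
    rw [← Finset.sum_range_reflect (fun j => 1 + Real.log ((2 * n + 1 : ℕ) : ℝ) - Real.log ((j : ℝ) + 1)) (n + 1)]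
    refine Finset.sum_congr rfl fun t ht => ?_
    have ht' := Finset.mem_range.mp ht
    have e : ((n + 1 - t : ℕ) : ℝ) = ((n + 1 - 1 - t : ℕ) : ℝ) + 1 := by
      rw [show n + 1 - t = (n + 1 - 1 - t) + 1 by omega]; push_cast; ring
    rw [e]
  rw [hrefl]
  have h3 := sum_range_one_add_log_sub_log_le (N := n + 1) (M := 2 * n + 1) (by omega) (by omega) (by omega)
  have hN : (0 : ℝ) ≤ ((n : ℝ) + 1) ^ (d - 1) := by positivity
  calc 2 * (d : ℝ) * 3 ^ (d - 1) * (((n : ℝ) + 1) ^ (d - 1) * ∑ j ∈ Finset.range (n + 1), (1 + Real.log ((2 * n + 1 : ℕ) : ℝ) - Real.log ((j : ℝ) + 1)))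
      ≤ 2 * (d : ℝ) * 3 ^ (d - 1) * (((n : ℝ) + 1) ^ (d - 1) * (3 * ((n + 1 : ℕ) : ℝ))) := by
        apply mul_le_mul_of_nonneg_left _ hκ
        exact mul_le_mul_of_nonneg_left h3 hN
    _ = 6 * d * 3 ^ (d - 1) * ((n : ℝ) + 1) ^ d := by
        have ed : ((n : ℝ) + 1) ^ d = ((n : ℝ) + 1) ^ (d - 1) * ((n : ℝ) + 1) := by rw [← pow_succ, Nat.sub_add_cancel hd]
        rw [ed]; push_cast; ring

/-- [folklore] FAR block pairs (`‖y − y′‖∞ ≥ 2`), any exponent `p ≤ 2d`: every pair of sites is at sup distance `≥ n + 1`, so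
`Σ_{x∈B n y} Σ_{x′∈B n y′} nrm(x−x′)^{−p} ≤ (n+1)^{2d−p}`. -/
theorem sum_B_sum_B_inv_nrm_pow_le_of_far (hd : 0 < d) {p : ℕ} (hp : p ≤ 2 * d) (n : ℕ) {y y' : X d}
    (hD : 2 ≤ supNorm (y - y')) :
    ∑ x ∈ B n y, ∑ x' ∈ B n y', 1 / nrm (x - x') ^ p ≤ ((n : ℝ) + 1) ^ (2 * d - p) := by
  have hn0 : (0 : ℝ) ≤ n := Nat.cast_nonneg n
  have hn1 : (0 : ℝ) < (n : ℝ) + 1 := by linarith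
  have hD2 : (2 : ℝ) ≤ (supNorm (y - y') : ℝ) := by exact_mod_cast hD
  have hterm : ∀ x ∈ B n y, ∀ x' ∈ B n y', 1 / nrm (x - x') ^ p ≤ 1 / ((n : ℝ) + 1) ^ p := by
    intro x hx x' hx'
    have hlow := supNorm_sub_ge_of_mem_B hd hx hx'
    have hN : (n : ℝ) + 1 ≤ nrm (x - x') := by
      have : (n : ℝ) + 1 ≤ (supNorm (x - x') : ℝ) := by nlinarith
      exact this.trans (supNorm_le_nrm _)
    exact one_div_le_one_div_of_le (by positivity) (pow_le_pow_left₀ hn1.le hN p)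
  refine (Finset.sum_le_sum fun x hx => Finset.sum_le_sum fun x' hx' => hterm x hx x' hx').trans (le_of_eq ?_)
  rw [Finset.sum_const, nsmul_eq_mul, card_B, Finset.sum_const, nsmul_eq_mul, card_B, pow_sub₀ _ hn1.ne' hp, two_mul,
    pow_add]
  ring

/-- [folklore] **DISTINCT BLOCKS AT THE CRITICAL EXPONENT ARE LOG-FREE.**  For every pair of DIFFERENT blocks (adjacent across a face, an edge, a corner,
or far): `Σ_{x∈B n y} Σ_{x′∈B n y′} nrm(x−x′)^{−d} ≤ (1 + 6d·3^{d−1})·(n+1)^d` — no `log n`; the logarithm of the critical window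
(`LatticeHLSRadial.sum_inv_nrm_pow_crit_le`, leaf-04 g25's `BlockPairRieszCount.sum_box_box_inv_nrm_four_le_d4`) is carried by the SAME-block pair only. -/
theorem sum_B_sum_B_inv_nrm_crit_le_of_ne (hd : 0 < d) (n : ℕ) {y y' : X d} (hne : y ≠ y') :
    ∑ x ∈ B n y, ∑ x' ∈ B n y', 1 / nrm (x - x') ^ d ≤ (1 + 6 * d * 3 ^ (d - 1)) * ((n : ℝ) + 1) ^ d := by
  have hn0 : (0 : ℝ) ≤ n := Nat.cast_nonneg n
  have hpow : (0 : ℝ) ≤ ((n : ℝ) + 1) ^ d := by positivity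
  have hκ : (0 : ℝ) ≤ 6 * d * 3 ^ (d - 1) := by positivity
  -- the adjacent case in either orientation
  have hadj : ∀ {u u' : X d}, supNorm (u' - u) ≤ 1 → ∀ {i : Fin d}, u' i = u i + 1 →
      ∑ x ∈ B n u, ∑ x' ∈ B n u', 1 / nrm (x - x') ^ d ≤ (1 + 6 * d * 3 ^ (d - 1)) * ((n : ℝ) + 1) ^ d :=
    fun huu _ hi => (sum_B_sum_B_inv_nrm_crit_le_of_succ hd n huu hi).trans (by nlinarith)
  rcases Nat.lt_or_ge (supNorm (y' - y)) 2 with hD | hD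
  · -- D ≤ 1; D ≠ 0 since y ≠ y′ ⇒ D = 1 ⇒ a coordinate with |y′ i − y i| = 1
    have hD0 : supNorm (y' - y) ≠ 0 := fun h => hne (sub_eq_zero.mp (PoissonInterior.supNorm_eq_zero_iff.mp h)).symm
    have hD1 : supNorm (y' - y) = 1 := by omega
    obtain ⟨i, hi⟩ := exists_natAbs_eq_supNorm hd (y' - y)
    rw [hD1] at hi
    rcases Int.natAbs_eq ((y' - y) i) with h | h <;> rw [hi, Pi.sub_apply] at h
    · -- y' i = y i + 1
      exact hadj hD1.le (by push_cast at h; linarith)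
    · -- y i = y' i + 1: swap the roles of the two blocks
      have hD1' : supNorm (y - y') ≤ 1 := by rw [← supNorm_neg, neg_sub]; exact hD1.le
      rw [Finset.sum_comm]
      simp_rw [nrm_sub_comm]  -- hmm: rewrites nrm (x - x') to nrm (x' - x) inside the swapped sum
      exact hadj hD1' (i := i) (by push_cast at h; linarith)
  · have hD' : 2 ≤ supNorm (y - y') := by rw [← supNorm_neg, neg_sub]; exact hD
    refine (sum_B_sum_B_inv_nrm_pow_le_of_far hd (p := d) (by omega) n hD').trans ?_
    rw [show 2 * d - d = d by omega]
    nlinarith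

end CriticalOffBlock

/-! ## §3 The `d = 4` reading in the road's convention (blocks `B (n − 1) y` of side `n`, `[NeZero n]`) -/

section Four

variable (n : ℕ) [NeZero n]

/-- [folklore] **`d = 4`: DISTINCT blocks of side `n` at the critical exponent `p = 4`** (two bare Coulomb gradients ∕ «two bare legs»):
`Σ_{x∈B(n−1)y} Σ_{x′∈B(n−1)y′} nrm(x−x′)⁻⁴ ≤ 649·n⁴` for `y ≠ y′` — log-FREE (leaf-04 g25's all-pairs bound is `n⁴·(1 + 216·(1 + log(2n−1)))`; the `log`
is the same-block pair's). -/
theorem sum_B_sum_B_inv_nrm_four_le_of_ne_four {y y' : X 4} (hne : y ≠ y') :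
    ∑ x ∈ B (n - 1) y, ∑ x' ∈ B (n - 1) y', 1 / nrm (x - x') ^ 4 ≤ 649 * (n : ℝ) ^ 4 := by
  have h := sum_B_sum_B_inv_nrm_crit_le_of_ne (d := 4) (by norm_num) (n - 1) hne
  rw [cast_pred_add_one n] at h
  refine h.trans (le_of_eq ?_)
  norm_num

end Four

end

end Summit.QuantumFields.BalabanUV.Gaps.BlockPairCriticalOffBlock
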